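import Literature.Geometry.DiscreteGeometry.ShellCensusSearchGrowthB
import HarnessLib

/-!
# Soundness of the census growth search, part C: closed-up leaves are complete

Topic `Literature/Geometry/DiscreteGeometry`.  A realized Phase-1 state without an open side has
all twelve labels and all twenty triangles placed: the used labels are closed under bonds, an
unused label would force a bond-closed set of five (a bond `K₅`, impossible: three triangles on a
side) or of six labels (a bond octahedron, whose stars are the dead pattern `4T`).
-/

namespace Literature.Geometry.DiscreteGeometry

namespace ShellCensusSearch

open Finset

namespace CF

variable {M : CF}

/-- Membership in `partners`. [folklore] -/
theorem mem_partners {x y : Fin 12} : y ∈ M.partners x ↔ M.bond x y = true := by simp [partners]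

/-- Four partners. [folklore] -/
theorem card_partners (x : Fin 12) : (M.partners x).card = 4 := M.bond_four x

/-- A label is not its own partner. [folklore] -/
theorem not_mem_partners_self (x : Fin 12) : x ∉ M.partners x := by
  rw [mem_partners, M.bond_irrefl]; exact Bool.false_ne_true

/-- **No bond-closed set of five labels** (it would be a bond `K₅`: three bond triangles on one
side). [folklore] -/
theorem no_closed_five {W : Finset (Fin 12)} (hW : W.card = 5) (hcl : ∀ x ∈ W, ∀ y, M.bond x y = true → y ∈ W) :
    False := by
  classical
  -- every pair in W is bonded
  have hall : ∀ x ∈ W, ∀ y ∈ W, x ≠ y → M.bond x y = true := by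
    intro x hx y hy hxy
    have hsub : M.partners x ⊆ W.erase x := by
      intro z hz
      exact mem_erase.2 ⟨fun e => not_mem_partners_self x (e ▸ hz), hcl x hx z (mem_partners.1 hz)⟩
    have heq : M.partners x = W.erase x :=
      eq_of_subset_of_card_le hsub (by rw [card_erase_of_mem hx, hW, card_partners])
    have : y ∈ W.erase x := mem_erase.2 ⟨hxy.symm, hy⟩
    rw [← heq] at this
    exact mem_partners.1 this
  -- pick u, a and three more labels b, c, d of W
  obtain ⟨u, hu⟩ : W.Nonempty := by rw [← card_pos, hW]; norm_num
  obtain ⟨a, ha⟩ : (W.erase u).Nonempty := by rw [← card_pos, card_erase_of_mem hu, hW]; norm_num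
  have ha' := mem_erase.1 ha
  set R := (W.erase u).erase a with hR
  have hRc : R.card = 3 := by rw [hR, card_erase_of_mem ha, card_erase_of_mem hu, hW]
  obtain ⟨b, c, d, hbc, hbd, hcd, hRe⟩ := card_eq_three.1 hRc
  have hb : b ∈ R := by rw [hRe]; simp
  have hc : c ∈ R := by rw [hRe]; simp
  have hd : d ∈ R := by rw [hRe]; simp
  simp only [hR, mem_erase] at hb hc hd
  -- the three bond triangles {u,a,b}, {u,a,c}, {u,a,d}
  have tri_of : ∀ y, y ∈ W → y ≠ u → y ≠ a → ({u, a, y} : Finset (Fin 12)) ∈ M.tri := by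
    intro y hy hyu hya
    exact M.bond_tri u a y (Ne.symm ha'.1) hya.symm hyu.symm (hall u hu a ha'.2 (Ne.symm ha'.1))
      (hall a ha'.2 y hy hya.symm) (hall u hu y hy hyu.symm)
  have Tb := tri_of b hb.2.2 hb.2.1 hb.1
  have Tc := tri_of c hc.2.2 hc.2.1 hc.1
  have Td := tri_of d hd.2.2 hd.2.1 hd.1
  have hua : u ≠ a := Ne.symm ha'.1
  rcases at_most_two hua Tb Tc Td (by simp) (by simp) (by simp) (by simp) (by simp) (by simp) with e | e | e
  · have : b ∈ ({u, a, c} : Finset (Fin 12)) := e ▸ (by simp)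
    simp only [mem_insert, mem_singleton] at this
    rcases this with rfl | rfl | rfl
    · exact hb.2.1 rfl
    · exact hb.1 rfl
    · exact hbc rfl
  · have : b ∈ ({u, a, d} : Finset (Fin 12)) := e ▸ (by simp)
    simp only [mem_insert, mem_singleton] at this
    rcases this with rfl | rfl | rfl
    · exact hb.2.1 rfl
    · exact hb.1 rfl
    · exact hbd rfl
  · have : c ∈ ({u, a, d} : Finset (Fin 12)) := e ▸ (by simp)
    simp only [mem_insert, mem_singleton] at this
    rcases this with rfl | rfl | rfl
    · exact hc.2.1 rfl
    · exact hc.1 rfl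
    · exact hcd rfl

/-- In a bond-closed set of six labels every label has exactly one non-partner among the other
five. [folklore] -/
theorem nonpartner_six {W : Finset (Fin 12)} (hW : W.card = 6) (hcl : ∀ x ∈ W, ∀ y, M.bond x y = true → y ∈ W)
    {x : Fin 12} (hx : x ∈ W) : ((W.erase x).filter fun y => M.bond x y = false).card = 1 := by
  classical
  have hsub : M.partners x ⊆ W.erase x := by
    intro z hz
    exact mem_erase.2 ⟨fun e => not_mem_partners_self x (e ▸ hz), hcl x hx z (mem_partners.1 hz)⟩
  have heq : (W.erase x).filter (fun y => M.bond x y = true) = M.partners x := by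
    ext z; simp only [mem_filter, mem_partners]
    exact ⟨fun h => h.2, fun h => ⟨hsub (mem_partners.2 h), h⟩⟩
  have h := Finset.card_filter_add_card_filter_not (s := W.erase x) (fun y => M.bond x y = true)
  rw [heq, card_partners, card_erase_of_mem hx, hW] at h
  have : (W.erase x).filter (fun y => ¬ M.bond x y = true) = (W.erase x).filter fun y => M.bond x y = false := by
    ext z; simp
  rw [this] at h
  omega

/-- **No bond-closed set of six labels**: it is a bond octahedron, and the star of any of its
labels is the dead pattern `4T`. [folklore] -/
theorem no_closed_six {W : Finset (Fin 12)} (hW : W.card = 6) (hcl : ∀ x ∈ W, ∀ y, M.bond x y = true → y ∈ W) :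
    False := by
  classical
  -- non-partner facts
  have uniq : ∀ x ∈ W, ∀ y ∈ W, ∀ y' ∈ W, y ≠ x → y' ≠ x → M.bond x y = false → M.bond x y' = false → y = y' := by
    intro x hx y hy y' hy' hyx hy'x hb hb'
    have h1 := nonpartner_six hW hcl hx
    obtain ⟨m, hm⟩ := card_eq_one.1 h1
    have hym : y ∈ (W.erase x).filter fun y => M.bond x y = false := mem_filter.2 ⟨mem_erase.2 ⟨hyx, hy⟩, hb⟩
    have hy'm : y' ∈ (W.erase x).filter fun y => M.bond x y = false := mem_filter.2 ⟨mem_erase.2 ⟨hy'x, hy'⟩, hb'⟩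
    rw [hm, mem_singleton] at hym hy'm
    rw [hym, hy'm]
  have exnp : ∀ x ∈ W, ∃ m ∈ W, m ≠ x ∧ M.bond x m = false := by
    intro x hx
    have h1 := nonpartner_six hW hcl hx
    obtain ⟨m, hm⟩ := card_eq_one.1 h1
    have : m ∈ (W.erase x).filter fun y => M.bond x y = false := by rw [hm]; simp
    rw [mem_filter, mem_erase] at this
    exact ⟨m, this.1.2, this.1.1, this.2⟩
  -- bonded unless the non-partner
  have bond_or : ∀ x ∈ W, ∀ y ∈ W, y ≠ x → M.bond x y = true ∨ M.bond x y = false := fun x _ y _ _ => by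
    cases M.bond x y <;> simp
  obtain ⟨u, hu⟩ : W.Nonempty := by rw [← card_pos, hW]; norm_num
  obtain ⟨nu, hnuW, hnuu, hnub⟩ := exnp u hu
  -- a partner a of u and its non-partner c
  obtain ⟨a, haW, hau, hanu⟩ : ∃ a ∈ W, a ≠ u ∧ a ≠ nu := by
    have : ((W.erase u).erase nu).Nonempty := by
      rw [← card_pos, card_erase_of_mem (mem_erase.2 ⟨hnuu, hnuW⟩), card_erase_of_mem hu, hW]; norm_num
    obtain ⟨a, ha⟩ := this
    simp only [mem_erase] at ha
    exact ⟨a, ha.2.2, ha.2.1, ha.1⟩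
  have hua : M.bond u a = true := by
    rcases bond_or u hu a haW hau with h | h
    · exact h
    · exact absurd (uniq u hu a haW nu hnuW hau hnuu h hnub) hanu
  obtain ⟨c, hcW, hca, hacb⟩ := exnp a haW
  have hcu : c ≠ u := by rintro rfl; rw [M.bond_symm] at hacb; rw [hacb] at hua; exact Bool.false_ne_true hua
  have hcnu : c ≠ nu := by
    rintro rfl
    -- c = nu is a non-partner of both u and a
    have := uniq c hcW u hu a haW hcu.symm hca.symm (by rw [M.bond_symm]; exact hnub) (by rw [M.bond_symm]; exact hacb)
    exact hau this.symm
  have huc : M.bond u c = true := by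
    rcases bond_or u hu c hcW hcu with h | h
    · exact h
    · exact absurd (uniq u hu c hcW nu hnuW hcu hnuu h hnub) hcnu
  -- the remaining two labels b, d
  set R := (((W.erase u).erase nu).erase a).erase c with hR
  have hRc : R.card = 2 := by
    rw [hR, card_erase_of_mem, card_erase_of_mem, card_erase_of_mem, card_erase_of_mem hu, hW]
    · exact mem_erase.2 ⟨hnuu, hnuW⟩
    · exact mem_erase.2 ⟨hanu, mem_erase.2 ⟨hau, haW⟩⟩
    · exact mem_erase.2 ⟨hca, mem_erase.2 ⟨hcnu, mem_erase.2 ⟨hcu, hcW⟩⟩⟩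
  obtain ⟨b, d, hbd, hRe⟩ := card_eq_two.1 hRc
  have hb : b ∈ R := by rw [hRe]; simp
  have hd : d ∈ R := by rw [hRe]; simp
  simp only [hR, mem_erase] at hb hd
  obtain ⟨hbc, hba, hbnu, hbu, hbW⟩ := hb
  obtain ⟨hdc, hda, hdnu, hdu, hdW⟩ := hd
  -- bonds: u~b, u~d, a~b, a~d, c~b, c~d, and b≁d
  have bnd : ∀ x ∈ W, ∀ m ∈ W, m ≠ x → M.bond x m = false → ∀ y ∈ W, y ≠ x → y ≠ m → M.bond x y = true := by
    intro x hx m hm hmx hxm y hy hyx hym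
    rcases bond_or x hx y hy hyx with h | h
    · exact h
    · exact absurd (uniq x hx y hy m hm hyx hmx h hxm) hym
  have hub := bnd u hu nu hnuW hnuu hnub b hbW hbu hbnu
  have hud := bnd u hu nu hnuW hnuu hnub d hdW hdu hdnu
  have hab := bnd a haW c hcW hca hacb b hbW hba hbc
  have had := bnd a haW c hcW hca hacb d hdW hda hdc
  have hca' : M.bond c a = false := by rw [M.bond_symm]; exact hacb
  have hcb := bnd c hcW a haW hca.symm hca' b hbW hbc hba
  have hcd := bnd c hcW a haW hca.symm hca' d hdW hdc hda
  have hbd' : M.bond b d = false := by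
    -- the non-partner of b is not u, a, c, nu? it is d: b's non-partner m ≠ b lies in W; it is none of u, a, c
    obtain ⟨m, hmW, hmb, hbm⟩ := exnp b hbW
    have hmu : m ≠ u := by rintro rfl; rw [M.bond_symm] at hbm; rw [hbm] at hub; exact Bool.false_ne_true hub
    have hma : m ≠ a := by rintro rfl; rw [M.bond_symm] at hbm; rw [hbm] at hab; exact Bool.false_ne_true hab
    have hmc : m ≠ c := by rintro rfl; rw [M.bond_symm] at hbm; rw [hbm] at hcb; exact Bool.false_ne_true hcb
    have hmnu : m ≠ nu := by
      rintro rfl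
      have := uniq m hmW u hu b hbW hmu.symm hmb.symm (by rw [M.bond_symm]; exact hnub) (by rw [M.bond_symm]; exact hbm)
      exact hbu this.symm
    -- m ∈ R = {b, d}, m ≠ b ⇒ m = d
    have hmR : m ∈ R := by
      rw [hR]; simp only [mem_erase]; exact ⟨hmc, hma, hmnu, hmu, hmW⟩
    rw [hRe] at hmR
    simp only [mem_insert, mem_singleton] at hmR
    rcases hmR with rfl | rfl
    · exact absurd rfl hmb
    · exact hbm
  -- the four bond triangles around u: u-a, a-b? we use the cycle a, b, c, d around u: a~b, b~c, c~d, d~a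
  have hbc' : M.bond b c = true := by rw [M.bond_symm]; exact hcb
  have hda' : M.bond d a = true := by rw [M.bond_symm]; exact had
  have T1 := M.bond_tri u a b hau.symm hba.symm hbu.symm hua hab hub
  have T2 := M.bond_tri u b c hbu.symm hbc hcu.symm hub hbc' huc
  have T3 := M.bond_tri u c d hcu.symm hdc.symm hdu.symm huc hcd hud
  have T4 := M.bond_tri u d a hdu.symm hda hau.symm hud hda' hua
  -- the star of u is exactly these four
  set A : Finset (Finset (Fin 12)) := {{u, a, b}, {u, b, c}, {u, c, d}, {u, d, a}} with hA
  have hAsub : A ⊆ M.star u := by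
    intro S hS
    simp only [hA, mem_insert, mem_singleton] at hS
    rcases hS with rfl | rfl | rfl | rfl
    · exact mem_star.2 ⟨T1, by simp⟩
    · exact mem_star.2 ⟨T2, by simp⟩
    · exact mem_star.2 ⟨T3, by simp⟩
    · exact mem_star.2 ⟨T4, by simp⟩
  have hAeq : A = M.star u := by
    refine star_eq_of_closed hAsub ⟨_, by rw [hA]; exact mem_insert_self _ _⟩ ?_
    intro S hS w hwS hwu S' hS' huS' hwS'
    -- w is one of a, b, c, d; the two triangles of A through w catch S'
    have key : ∀ w, (w = a ∨ w = b ∨ w = c ∨ w = d) → w ∈ S' → S' ∈ A := by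
      intro w hw hwS'
      rcases hw with rfl | rfl | rfl | rfl
      · rcases at_most_two hau.symm T1 T4 hS' (by simp) (by simp) (by simp) (by simp) huS' hwS' with e | e | e
        · exfalso
          have : b ∈ ({u, d, w} : Finset (Fin 12)) := e ▸ (by simp)
          simp only [mem_insert, mem_singleton] at this
          rcases this with rfl | rfl | rfl
          · exact hbu rfl
          · exact hbd rfl
          · exact hba rfl
        · rw [hA, ← e]; simp
        · rw [hA, ← e]; simp
      · rcases at_most_two hbu.symm T1 T2 hS' (by simp) (by simp) (by simp) (by simp) huS' hwS' with e | e | e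
        · exfalso
          have : a ∈ ({u, w, c} : Finset (Fin 12)) := e ▸ (by simp)
          simp only [mem_insert, mem_singleton] at this
          rcases this with rfl | rfl | rfl
          · exact hau rfl
          · exact hba rfl
          · exact hca rfl
        · rw [hA, ← e]; simp
        · rw [hA, ← e]; simp
      · rcases at_most_two hcu.symm T2 T3 hS' (by simp) (by simp) (by simp) (by simp) huS' hwS' with e | e | e
        · exfalso
          have : b ∈ ({u, w, d} : Finset (Fin 12)) := e ▸ (by simp)
          simp only [mem_insert, mem_singleton] at this
          rcases this with rfl | rfl | rfl
          · exact hbu rfl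
          · exact hbc rfl
          · exact hbd rfl
        · rw [hA, ← e]; simp
        · rw [hA, ← e]; simp
      · rcases at_most_two hdu.symm T3 T4 hS' (by simp) (by simp) (by simp) (by simp) huS' hwS' with e | e | e
        · exfalso
          have : c ∈ ({u, w, a} : Finset (Fin 12)) := e ▸ (by simp)
          simp only [mem_insert, mem_singleton] at this
          rcases this with rfl | rfl | rfl
          · exact hcu rfl
          · exact hdc rfl
          · exact hca rfl
        · rw [hA, ← e]; simp
        · rw [hA, ← e]; simp
    simp only [hA, mem_insert, mem_singleton] at hS
    rcases hS with rfl | rfl | rfl | rfl <;> simp only [mem_insert, mem_singleton] at hwS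
    · rcases hwS with rfl | rfl | rfl
      · exact absurd rfl hwu
      · exact key w (Or.inl rfl) hwS'
      · exact key w (Or.inr (Or.inl rfl)) hwS'
    · rcases hwS with rfl | rfl | rfl
      · exact absurd rfl hwu
      · exact key w (Or.inr (Or.inl rfl)) hwS'
      · exact key w (Or.inr (Or.inr (Or.inl rfl))) hwS'
    · rcases hwS with rfl | rfl | rfl
      · exact absurd rfl hwu
      · exact key w (Or.inr (Or.inr (Or.inl rfl))) hwS'
      · exact key w (Or.inr (Or.inr (Or.inr rfl))) hwS'
    · rcases hwS with rfl | rfl | rfl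
      · exact absurd rfl hwu
      · exact key w (Or.inr (Or.inr (Or.inr rfl))) hwS'
      · exact key w (Or.inl rfl) hwS'
  -- the dead pattern 4T
  refine M.noFourT u a b c d ?_ hua hub huc hud hab hbc' hcd hda'
  rw [← star, ← hAeq]

end CF

namespace Realizes

variable {M : CF} {φ : ℕ → Fin 12} {s : St}

/-- Without an open side every used label has its whole star placed. [folklore] -/
theorem all_star_placed (h : Realizes M φ s) (hnone : s.chooseOpen = none) {v : ℕ} (hv : v < s.n) :
    ∀ T ∈ M.tri, φ v ∈ T → ∃ t ∈ s.tris.toList, tset φ t = T := by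
  refine h.star_placed hv fun u hu huv h0 => ?_
  have hle := h.gsc_le_two hv hu (Ne.symm huv)
  have hne1 := chooseOpen_none hnone hv hu (Ne.symm huv)
  omega

/-- Without an open side the used labels are closed under bonds. [folklore] -/
theorem used_of_bond (h : Realizes M φ s) (hnone : s.chooseOpen = none) {v : ℕ} (hv : v < s.n) {w : Fin 12}
    (hb : M.bond (φ v) w = true) : ∃ u, u < s.n ∧ φ u = w := by
  have hw := CF.mem_linkF_of_bond hb
  simp only [CF.linkF, mem_filter, mem_univ, true_and] at hw
  obtain ⟨-, S, hS, hwS⟩ := hw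
  obtain ⟨hS1, hS2⟩ := CF.mem_star.1 hS
  obtain ⟨t, ht, rfl⟩ := h.all_star_placed hnone hv S hS1 hS2
  obtain ⟨u, hu, rfl⟩ := exists_label_of_mem_tset hwS
  exact ⟨u, h.lt_n ht hu, rfl⟩

/-- **A closed-up leaf is complete**: twelve labels, twenty triangles, every triangle placed.
[folklore] -/
theorem complete_of_no_open (h : Realizes M φ s) (hnone : s.chooseOpen = none) :
    s.n = 12 ∧ s.tris.size = 20 ∧ ∀ T ∈ M.tri, ∃ t ∈ s.tris.toList, tset φ t = T := by
  classical
  set I : Finset (Fin 12) := (Finset.range s.n).image φ with hI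
  have hinj : Set.InjOn φ (Finset.range s.n : Set ℕ) := by
    intro a ha b hb he
    exact h.inj a b (by simpa using ha) (by simpa using hb) he
  have hcardI : I.card = s.n := by rw [hI, card_image_of_injOn hinj, card_range]
  have hmemI : ∀ w, w ∈ I ↔ ∃ u, u < s.n ∧ φ u = w := by
    intro w; rw [hI, mem_image]; simp
  -- I is bond-closed
  have hIcl : ∀ x ∈ I, ∀ y, M.bond x y = true → y ∈ I := by
    intro x hx y hb
    obtain ⟨v, hv, rfl⟩ := (hmemI x).1 hx
    obtain ⟨u, hu, rfl⟩ := h.used_of_bond hnone hv hb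
    exact (hmemI _).2 ⟨u, hu, rfl⟩
  -- the complement is bond-closed
  have hCcl : ∀ x ∈ Finset.univ \ I, ∀ y, M.bond x y = true → y ∈ Finset.univ \ I := by
    intro x hx y hb
    rw [mem_sdiff] at hx ⊢
    refine ⟨mem_univ _, fun hy => hx.2 ?_⟩
    exact hIcl y hy x (by rw [M.bond_symm]; exact hb)
  -- sizes
  have hI5 : 5 ≤ I.card := by
    have h0 : φ 0 ∈ I := (hmemI _).2 ⟨0, by have := h.three_le; omega, rfl⟩
    have hsub : insert (φ 0) (M.partners (φ 0)) ⊆ I := by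
      intro y hy
      rw [mem_insert] at hy
      rcases hy with rfl | hy
      · exact h0
      · exact hIcl _ h0 y (CF.mem_partners.1 hy)
    have := card_le_card hsub
    rw [card_insert_of_notMem (CF.not_mem_partners_self _), CF.card_partners] at this
    omega
  have hC : (Finset.univ \ I).card = 12 - s.n := by
    rw [card_sdiff_of_subset (subset_univ I), card_univ, Fintype.card_fin, hcardI]
  have hn12 : s.n = 12 := by
    by_contra hne
    have hlt : s.n < 12 := lt_of_le_of_ne h.n_le hne
    -- an unused label and its partners
    obtain ⟨w, hw⟩ : (Finset.univ \ I).Nonempty := by rw [← card_pos, hC]; omega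
    have hsub : insert w (M.partners w) ⊆ Finset.univ \ I := by
      intro y hy
      rw [mem_insert] at hy
      rcases hy with rfl | hy
      · exact hw
      · exact hCcl _ hw y (CF.mem_partners.1 hy)
    have h5 := card_le_card hsub
    rw [card_insert_of_notMem (CF.not_mem_partners_self _), CF.card_partners, hC] at h5
    -- n ∈ {5, 6, 7}
    have hn : s.n = 5 ∨ s.n = 6 ∨ s.n = 7 := by omega
    rcases hn with hn | hn | hn
    · exact CF.no_closed_five (by rw [hcardI, hn]) hIcl
    · exact CF.no_closed_six (by rw [hcardI, hn]) hIcl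
    · exact CF.no_closed_five (by rw [hC, hn]) hCcl
  -- complete
  have hIuniv : I = Finset.univ := eq_univ_of_card _ (by rw [hcardI, hn12]; simp)
  have hall : ∀ T ∈ M.tri, ∃ t ∈ s.tris.toList, tset φ t = T := by
    intro T hT
    obtain ⟨x, hx⟩ : T.Nonempty := by rw [← card_pos, M.tri_card T hT]; norm_num
    obtain ⟨v, hv, rfl⟩ := (hmemI x).1 (hIuniv ▸ mem_univ x)
    exact h.all_star_placed hnone hv T hT hx
  refine ⟨hn12, ?_, hall⟩
  -- twenty placed triangles
  have heq : s.tris.toList.toFinset.image (tset φ) = M.tri := by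
    ext T
    rw [mem_image]
    constructor
    · rintro ⟨t, ht, rfl⟩; exact h.mem t (by simpa using ht)
    · intro hT
      obtain ⟨t, ht, he⟩ := hall T hT
      exact ⟨t, by simpa using ht, he⟩
  have hc := congrArg Finset.card heq
  rw [M.card_tri, card_image_of_injOn, List.toFinset_card_of_nodup h.nodup, Array.length_toList] at hc
  · exact hc
  · intro t ht t' ht' he
    exact h.eq_of_tset_eq (by simpa using ht) (by simpa using ht') he

end Realizes

end ShellCensusSearch

end Literature.Geometry.DiscreteGeometry
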